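import Summits.Ventures.PercRepro.S2SquareMultiplicity3

/-!
# PercRepro — S2: THE CUBIC MULTIPLICITY, PART A — supports, recovery, the facts (c) / (d) and the rank step
(p4, gen 16; paper proofs/P4-MULT-CUBE.md; a feeder for sub-claim S4 and the fibre weights of p7's giant count)

For an independent set `I` and extras `T ⊆ cl(I) ∖ I`: the SUPPORT of `t ∈ T` is `C(t, I) ∖ {t} ⊆ I`, and
`x ∈ C(t, I)` iff `t ∉ cl(I ∖ {x})` (`mem_fundCircuit_iff_notMem_closure_sdiff`); a support element is recovered
by its extra (`mem_closure_insert_of_mem_fundCircuit`). A pair `{x, y}` of support elements is GOOD when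
`I ⊆ cl((I ∖ {x, y}) ∪ T)`: if one of `x, y` lies in that closure so does the other (`mem_closure_pair_of_mem`),
and BAD is transitive (`notMem_closure_pair_trans`, closure exchange). Rank bookkeeping: a bad pair has
`r((I ∖ {x, y}) ∪ T) = |I| − 1` (`eRk_sdiff_pair_union_of_bad`) and the submodular step
`eRk_sdiff_union_step` for the induction of Part B. Axioms: standard.
-/

open scoped Matroid

namespace PercRepro

namespace S2

open Set

variable {α : Type} {M : Matroid α}

/-- `x ∈ C(t, I)` (for `x ∈ I`, `t ∈ cl(I) ∖ I`) iff `t ∉ cl(I ∖ {x})`. -/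
theorem mem_fundCircuit_iff_notMem_closure_sdiff {I : Set α} (hI : M.Indep I) {t x : α}
    (htcl : t ∈ M.closure I) (htI : t ∉ I) (hxI : x ∈ I) :
    x ∈ M.fundCircuit t I ↔ t ∉ M.closure (I \ {x}) := by
  have hxt : x ≠ t := fun h => htI (h ▸ hxI)
  rw [hI.mem_fundCircuit_iff htcl htI]
  have heq : insert t I \ {x} = insert t (I \ {x}) := by
    ext a
    simp only [Set.mem_sdiff, Set.mem_insert_iff, Set.mem_singleton_iff]
    constructor
    · rintro ⟨h1 | h1, h2⟩
      · exact Or.inl h1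
      · exact Or.inr ⟨h1, h2⟩
    · rintro (h | ⟨h1, h2⟩)
      · exact ⟨Or.inl h, fun h' => hxt (h' ▸ h)⟩
      · exact ⟨Or.inr h1, h2⟩
  rw [heq, (hI.subset Set.sdiff_subset).insert_indep_iff]
  have htE : t ∈ M.E := M.mem_ground_of_mem_closure htcl
  constructor
  · rintro (h | h)
    · exact h.2
    · exact absurd h.1 htI
  · intro h
    exact Or.inl ⟨htE, h⟩

/-- A support element is recovered by its extra: `x ∈ C(t, I)` gives `x ∈ cl((I ∖ {x}) ∪ {t})`. -/
theorem mem_closure_insert_of_mem_fundCircuit {I : Set α} (hI : M.Indep I) {t x : α}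
    (htcl : t ∈ M.closure I) (htI : t ∉ I) (hxI : x ∈ I) (hx : x ∈ M.fundCircuit t I) :
    x ∈ M.closure (insert t (I \ {x})) := by
  have h1 : t ∉ M.closure (I \ {x}) := (mem_fundCircuit_iff_notMem_closure_sdiff hI htcl htI hxI).1 hx
  have h2 : t ∈ M.closure (insert x (I \ {x})) := by
    rwa [Set.insert_sdiff_singleton, Set.insert_eq_of_mem hxI]
  exact Matroid.mem_closure_insert h1 h2

/-- If `x ∈ C(t, I)` and `A ⊆ I ∖ {x}` then `t ∉ cl(A)`. -/
theorem notMem_closure_of_mem_fundCircuit_of_subset {I : Set α} (hI : M.Indep I) {t x : α}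
    (htcl : t ∈ M.closure I) (htI : t ∉ I) (hxI : x ∈ I) (hx : x ∈ M.fundCircuit t I)
    {A : Set α} (hA : A ⊆ I \ {x}) : t ∉ M.closure A :=
  fun h => (mem_fundCircuit_iff_notMem_closure_sdiff hI htcl htI hxI).1 hx (M.closure_subset_closure hA h)

/-- `insert x (I ∖ {x, y}) = I ∖ {y}` for `x ∈ I`, `x ≠ y`. -/
theorem insert_sdiff_pair_eq {I : Set α} {x y : α} (hxI : x ∈ I) (hxy : x ≠ y) :
    insert x (I \ {x, y}) = I \ {y} := by
  ext a
  simp only [Set.mem_insert_iff, Set.mem_sdiff, Set.mem_singleton_iff, not_or]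
  constructor
  · rintro (rfl | ⟨h1, h2, h3⟩)
    · exact ⟨hxI, hxy⟩
    · exact ⟨h1, h3⟩
  · rintro ⟨h1, h2⟩
    by_cases hax : a = x
    · exact Or.inl hax
    · exact Or.inr ⟨h1, hax, h2⟩

/-- Fact (c): for a pair `{x, y}` of support elements, if `x` lies in `Z = cl((I ∖ {x, y}) ∪ T)` then so does `y`
(given `y ∈ C(t, I)` for some `t ∈ T`, `T ⊆ M.E`). -/
theorem mem_closure_pair_of_mem {I T : Set α} {x y t : α} (hI : M.Indep I) (hIE : I ⊆ M.E) (hTE : T ⊆ M.E)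
    (htcl : t ∈ M.closure I) (htI : t ∉ I) (hxI : x ∈ I) (hyI : y ∈ I) (hxy : x ≠ y)
    (hyt : y ∈ M.fundCircuit t I) (htT : t ∈ T)
    (hx : x ∈ M.closure ((I \ {x, y}) ∪ T)) :
    y ∈ M.closure ((I \ {x, y}) ∪ T) := by
  have hZE : (I \ {x, y}) ∪ T ⊆ M.E := Set.union_subset (Set.sdiff_subset.trans hIE) hTE
  have hAx : insert x (I \ {x, y}) = I \ {y} := insert_sdiff_pair_eq hxI hxy
  have ht1 : t ∉ M.closure (insert x (I \ {x, y})) := by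
    rw [hAx]; exact (mem_fundCircuit_iff_notMem_closure_sdiff hI htcl htI hyI).1 hyt
  have ht2 : t ∈ M.closure (insert y (insert x (I \ {x, y}))) := by
    have : insert y (insert x (I \ {x, y})) = I := by
      rw [hAx, Set.insert_sdiff_singleton, Set.insert_eq_of_mem hyI]
    rw [this]; exact htcl
  have hy : y ∈ M.closure (insert t (insert x (I \ {x, y}))) := Matroid.mem_closure_insert ht1 ht2
  have hsub : insert t (insert x (I \ {x, y})) ⊆ M.closure ((I \ {x, y}) ∪ T) := by
    intro a ha
    rcases ha with rfl | rfl | ha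
    · exact M.mem_closure_of_mem (Set.mem_union_right _ htT) hZE
    · exact hx
    · exact M.mem_closure_of_mem (Set.mem_union_left _ ha) hZE
  exact M.closure_subset_closure_of_subset_closure hsub hy

/-- `insert z ((I ∖ {x, y, z}) ∪ T) = (I ∖ {x, y}) ∪ T` for `z ∈ I`, `z ≠ x`, `z ≠ y`. -/
theorem insert_sdiff_triple_union {I T : Set α} {x y z : α} (hzI : z ∈ I) (hzx : z ≠ x) (hzy : z ≠ y) :
    insert z ((I \ {x, y, z}) ∪ T) = (I \ {x, y}) ∪ T := by
  ext a
  simp only [Set.mem_insert_iff, Set.mem_union, Set.mem_sdiff, Set.mem_singleton_iff, not_or]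
  constructor
  · rintro (rfl | ⟨h1, h2, h3, h4⟩ | h)
    · exact Or.inl ⟨hzI, hzx, hzy⟩
    · exact Or.inl ⟨h1, h2, h3⟩
    · exact Or.inr h
  · rintro (⟨h1, h2, h3⟩ | h)
    · by_cases haz : a = z
      · exact Or.inl haz
      · exact Or.inr (Or.inl ⟨h1, h2, h3, haz⟩)
    · exact Or.inr (Or.inr h)

/-- Fact (d), transitivity of BAD: with `x, y, z ∈ I` distinct, if `x ∉ cl((I ∖ {x, y}) ∪ T)` and
`y ∉ cl((I ∖ {y, z}) ∪ T)` then `x ∉ cl((I ∖ {x, z}) ∪ T)`. -/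
theorem notMem_closure_pair_trans {I T : Set α} {x y z : α} (hxI : x ∈ I) (hyI : y ∈ I) (hzI : z ∈ I)
    (hxy : x ≠ y) (hyz : y ≠ z) (hxz : x ≠ z)
    (h1 : x ∉ M.closure ((I \ {x, y}) ∪ T)) (h2 : y ∉ M.closure ((I \ {y, z}) ∪ T)) :
    x ∉ M.closure ((I \ {x, z}) ∪ T) := by
  intro hx
  set A := (I \ {x, y, z}) ∪ T with hA
  have e1 : (I \ {x, y}) ∪ T = insert z A := (insert_sdiff_triple_union hzI hxz.symm hyz.symm).symm
  have e2 : (I \ {x, z}) ∪ T = insert y A := by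
    rw [hA, show ({x, y, z} : Set α) = {x, z, y} from by rw [Set.pair_comm y z]]
    exact (insert_sdiff_triple_union hyI hxy.symm hyz).symm
  have e3 : (I \ {y, z}) ∪ T = insert x A := by
    rw [hA, show ({x, y, z} : Set α) = {y, z, x} from by
      rw [Set.insert_comm x y, Set.pair_comm x z]]
    exact (insert_sdiff_triple_union hxI hxy hxz).symm
  have hxA : x ∉ M.closure A := fun h => h1 (by rw [e1]; exact M.closure_subset_closure (Set.subset_insert _ _) h)
  rw [e2] at hx
  have hy : y ∈ M.closure (insert x A) := Matroid.mem_closure_insert hxA hx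
  rw [← e3] at hy
  exact h2 hy

/-- The rank of a set is a natural number (finite matroid). -/
theorem exists_eRk_eq_coe [M.Finite] (X : Set α) : ∃ k : ℕ, M.eRk X = (k : ℕ∞) := by
  obtain ⟨k, hk⟩ := ENat.ne_top_iff_exists.1 (M.isRkFinite_set X).eRk_lt_top.ne
  exact ⟨k, hk.symm⟩

open scoped Classical in
/-- `r(I ∖ S) = |I| − |S|` for `I` independent and `S ⊆ I` (finsets). -/
theorem eRk_coe_sdiff_coe {I S : Finset α} (hI : M.Indep (I : Set α)) (hS : S ⊆ I) :
    M.eRk ((I : Set α) \ (S : Set α)) = ((I.card - S.card : ℕ) : ℕ∞) := by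
  rw [← Finset.coe_sdiff, (hI.subset (by simp)).eRk_eq_encard, Set.encard_coe_eq_coe_finsetCard,
    Finset.card_sdiff_of_subset hS]

/-- An element of `T` outside `cl(A)` raises the rank: `r(A) + 1 ≤ r(A ∪ T)`. -/
theorem eRk_add_one_le_eRk_union_of_notMem_closure {A T : Set α} {t : α} (htE : t ∈ M.E)
    (htA : t ∉ M.closure A) (htT : t ∈ T) : M.eRk A + 1 ≤ M.eRk (A ∪ T) := by
  rw [← Matroid.eRk_insert_eq_add_one ⟨htE, htA⟩]
  exact M.eRk_mono (Set.insert_subset (Set.mem_union_right _ htT) Set.subset_union_left)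

/-- A subset of `cl(I)` of rank `|I|` has closure `cl(I)` (`I` a finite independent set). -/
theorem closure_eq_closure_of_eRk_eq [M.Finite] {I : Finset α} {Z : Set α} (hI : M.Indep (I : Set α))
    (hZ : Z ⊆ M.closure (I : Set α)) (hr : M.eRk Z = (I.card : ℕ∞)) :
    M.closure Z = M.closure (I : Set α) := by
  have h := (M.isRkFinite_set Z).closure_eq_closure_of_subset_of_eRk_ge_eRk hZ (by
    rw [M.eRk_closure_eq, hI.eRk_eq_encard, Set.encard_coe_eq_coe_finsetCard, hr])
  rw [h, M.closure_closure]

/-- `r(Z) ≤ |I|` for `Z ⊆ cl(I)`. -/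
theorem eRk_le_card_of_subset_closure {I : Finset α} {Z : Set α} (hI : M.Indep (I : Set α))
    (hZ : Z ⊆ M.closure (I : Set α)) : M.eRk Z ≤ (I.card : ℕ∞) := by
  have := M.eRk_mono hZ
  rwa [M.eRk_closure_eq, hI.eRk_eq_encard, Set.encard_coe_eq_coe_finsetCard] at this

open scoped Classical in
/-- A BAD pair `{x, y}` of support elements has `r((I ∖ {x, y}) ∪ T) = |I| − 1`: at most that since `x` is not
recovered, at least that since the extra `t` with `x ∈ C(t, I)` is outside `cl(I ∖ {x, y})`. -/
theorem eRk_sdiff_pair_union_of_bad [M.Finite] {I : Finset α} {T : Set α} {x y t : α}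
    (hI : M.Indep (I : Set α)) (hTcl : T ⊆ M.closure (I : Set α))
    (htE : t ∈ M.E) (htcl : t ∈ M.closure (I : Set α)) (htI : t ∉ I) (htT : t ∈ T)
    (hxI : x ∈ I) (hyI : y ∈ I) (hxy : x ≠ y) (hxt : x ∈ M.fundCircuit t (I : Set α))
    (hbad : x ∉ M.closure (((I : Set α) \ {x, y}) ∪ T)) :
    M.eRk (((I : Set α) \ {x, y}) ∪ T) = ((I.card - 2 + 1 : ℕ) : ℕ∞) := by
  set Z := ((I : Set α) \ {x, y}) ∪ T with hZ
  have hZcl : Z ⊆ M.closure (I : Set α) :=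
    Set.union_subset (Set.sdiff_subset.trans (M.subset_closure _ hI.subset_ground)) hTcl
  have hpair : ({x, y} : Set α) = (({x, y} : Finset α) : Set α) := by simp
  have hsub : ({x, y} : Finset α) ⊆ I := by
    intro a ha
    rcases Finset.mem_insert.1 ha with rfl | ha
    · exact hxI
    · exact (Finset.mem_singleton.1 ha) ▸ hyI
  have hcard2 : ({x, y} : Finset α).card = 2 := Finset.card_pair hxy
  -- lower bound
  have hlow : ((I.card - 2 : ℕ) : ℕ∞) + 1 ≤ M.eRk Z := by
    have h1 : M.eRk ((I : Set α) \ {x, y}) = ((I.card - 2 : ℕ) : ℕ∞) := by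
      rw [hpair, eRk_coe_sdiff_coe hI hsub, hcard2]
    have h2 : t ∉ M.closure ((I : Set α) \ {x, y}) :=
      notMem_closure_of_mem_fundCircuit_of_subset hI htcl htI hxI hxt (by
        intro a ha
        exact ⟨ha.1, fun h => ha.2 (by rw [Set.mem_singleton_iff.1 h]; exact Set.mem_insert x _)⟩)
    rw [← h1]
    exact eRk_add_one_le_eRk_union_of_notMem_closure htE h2 htT
  -- upper bound
  have hup : M.eRk Z ≤ (I.card : ℕ∞) := eRk_le_card_of_subset_closure hI hZcl
  have hne : M.eRk Z ≠ (I.card : ℕ∞) := by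
    intro h
    apply hbad
    have := closure_eq_closure_of_eRk_eq hI hZcl h
    rw [hZ, this]
    exact M.mem_closure_of_mem (by exact_mod_cast hxI) hI.subset_ground
  obtain ⟨k, hk⟩ := exists_eRk_eq_coe (M := M) Z
  rw [hk] at hlow hup hne ⊢
  have h2I : 2 ≤ I.card := by
    have := Finset.card_le_card hsub
    omega
  have hlow' : I.card - 2 + 1 ≤ k := by exact_mod_cast hlow
  have hup' : k ≤ I.card := by exact_mod_cast hup
  have hne' : k ≠ I.card := fun h => hne (by rw [h])
  congr 1
  omega

open scoped Classical in
/-- The induction step of «every pair is bad»: for `S ⊆ W` with `|S| = n + 1 ≥ 3` and `u ≠ z` in `S`, from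
`r((I ∖ (S ∖ u)) ∪ T) = r((I ∖ (S ∖ z)) ∪ T) = |I| − n + 1` follows `r((I ∖ S) ∪ T) = |I| − n` (submodularity and
the extras outside the closures of `I ∖ S` and `I ∖ (S ∖ {u, z})`). -/
theorem eRk_sdiff_union_step [M.Finite] {I S : Finset α} {T : Set α} {u z : α} (n : ℕ)
    (hI : M.Indep (I : Set α)) (hTE : T ⊆ M.E) (hTcl : T ⊆ M.closure (I : Set α))
    (hsupp : ∀ v ∈ S, ∃ t ∈ T, t ∉ I ∧ v ∈ M.fundCircuit t (I : Set α))
    (hSI : S ⊆ I) (hcard : S.card = n + 1) (h3 : 3 ≤ S.card) (huS : u ∈ S) (hzS : z ∈ S) (huz : u ≠ z)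
    (hu : M.eRk (((I : Set α) \ ((S.erase u : Finset α) : Set α)) ∪ T) = ((I.card - n + 1 : ℕ) : ℕ∞))
    (hz : M.eRk (((I : Set α) \ ((S.erase z : Finset α) : Set α)) ∪ T) = ((I.card - n + 1 : ℕ) : ℕ∞)) :
    M.eRk (((I : Set α) \ (S : Set α)) ∪ T) = ((I.card - (n + 1) + 1 : ℕ) : ℕ∞) := by
  set X := ((I : Set α) \ ((S.erase u : Finset α) : Set α)) ∪ T with hX
  set Y := ((I : Set α) \ ((S.erase z : Finset α) : Set α)) ∪ T with hY
  set R : Finset α := (S.erase u).erase z with hR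
  have hRS : R ⊆ S := (Finset.erase_subset _ _).trans (Finset.erase_subset _ _)
  have hRcard : R.card = n - 1 := by
    rw [hR, Finset.card_erase_of_mem (Finset.mem_erase.2 ⟨huz.symm, hzS⟩), Finset.card_erase_of_mem huS, hcard]
    omega
  have hXY_inter : X ∩ Y = ((I : Set α) \ (S : Set α)) ∪ T := by
    rw [hX, hY]
    ext a
    simp only [Set.mem_inter_iff, Set.mem_union, Set.mem_sdiff, Finset.mem_coe, Finset.mem_erase, ne_eq]
    constructor
    · rintro ⟨h1 | h1, h2 | h2⟩
      · left
        refine ⟨h1.1, fun haS => ?_⟩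
        by_cases hau : a = u
        · have haz : a = z := by
            by_contra haz
            exact h2.2 ⟨haz, haS⟩
          exact huz (hau.symm.trans haz)
        · exact h1.2 ⟨hau, haS⟩
      · exact Or.inr h2
      · exact Or.inr h1
      · exact Or.inr h1
    · rintro (h | h)
      · exact ⟨Or.inl ⟨h.1, fun h' => h.2 h'.2⟩, Or.inl ⟨h.1, fun h' => h.2 h'.2⟩⟩
      · exact ⟨Or.inr h, Or.inr h⟩
  have hXY_union : X ∪ Y = ((I : Set α) \ (R : Set α)) ∪ T := by
    rw [hX, hY, hR]
    ext a
    simp only [Set.mem_union, Set.mem_sdiff, Finset.mem_coe, Finset.mem_erase, ne_eq, not_and]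
    constructor
    · rintro ((h | h) | (h | h))
      · exact Or.inl ⟨h.1, fun _ h2 => h.2 h2⟩
      · exact Or.inr h
      · exact Or.inl ⟨h.1, fun h1 _ => h.2 h1⟩
      · exact Or.inr h
    · rintro (h | h)
      · by_cases hau : a = u
        · exact Or.inl (Or.inl ⟨h.1, fun h' => absurd hau h'⟩)
        · by_cases haz : a = z
          · exact Or.inr (Or.inl ⟨h.1, fun h' => absurd haz h'⟩)
          · exact Or.inl (Or.inl ⟨h.1, fun _ => h.2 haz hau⟩)
      · exact Or.inl (Or.inr h)
  -- the two lower bounds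
  have hSle : S.card ≤ I.card := Finset.card_le_card hSI
  have hlow1 : ((I.card - (n + 1) : ℕ) : ℕ∞) + 1 ≤ M.eRk (X ∩ Y) := by
    rw [hXY_inter]
    obtain ⟨t, htT, htI, hut⟩ := hsupp u huS
    have h1 : M.eRk ((I : Set α) \ (S : Set α)) = ((I.card - (n + 1) : ℕ) : ℕ∞) := by
      rw [eRk_coe_sdiff_coe hI hSI, hcard]
    have h2 : t ∉ M.closure ((I : Set α) \ (S : Set α)) :=
      notMem_closure_of_mem_fundCircuit_of_subset hI (hTcl htT) htI (hSI huS) hut (by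
        intro a ha
        exact ⟨ha.1, fun h => ha.2 (by rw [Set.mem_singleton_iff.1 h]; exact huS)⟩)
    rw [← h1]
    exact eRk_add_one_le_eRk_union_of_notMem_closure (hTE htT) h2 htT
  have hlow2 : ((I.card - (n - 1) : ℕ) : ℕ∞) + 1 ≤ M.eRk (X ∪ Y) := by
    rw [hXY_union]
    have hRne : R.Nonempty := by
      rw [← Finset.card_pos, hRcard]; omega
    obtain ⟨v, hvR⟩ := hRne
    obtain ⟨t, htT, htI, hvt⟩ := hsupp v (hRS hvR)
    have h1 : M.eRk ((I : Set α) \ (R : Set α)) = ((I.card - (n - 1) : ℕ) : ℕ∞) := by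
      rw [eRk_coe_sdiff_coe hI (hRS.trans hSI), hRcard]
    have h2 : t ∉ M.closure ((I : Set α) \ (R : Set α)) :=
      notMem_closure_of_mem_fundCircuit_of_subset hI (hTcl htT) htI (hSI (hRS hvR)) hvt (by
        intro a ha
        exact ⟨ha.1, fun h => ha.2 (by rw [Set.mem_singleton_iff.1 h]; exact hvR)⟩)
    rw [← h1]
    exact eRk_add_one_le_eRk_union_of_notMem_closure (hTE htT) h2 htT
  -- submodularity
  have hsub := M.eRk_inter_add_eRk_union_le X Y
  rw [hu, hz] at hsub
  obtain ⟨a, ha⟩ := exists_eRk_eq_coe (M := M) (X ∩ Y)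
  obtain ⟨b, hb⟩ := exists_eRk_eq_coe (M := M) (X ∪ Y)
  rw [ha, hb] at hsub
  rw [ha] at hlow1
  rw [hb] at hlow2
  rw [hXY_inter] at ha
  rw [ha]
  have hsub' : a + b ≤ (I.card - n + 1) + (I.card - n + 1) := by exact_mod_cast hsub
  have hlow1' : I.card - (n + 1) + 1 ≤ a := by exact_mod_cast hlow1
  have hlow2' : I.card - (n - 1) + 1 ≤ b := by exact_mod_cast hlow2
  congr 1
  omega

end S2

end PercRepro
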